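import Literature.Analysis.InnerProduct.ClosedHilbertComplexHodgeTheory
import Literature.Analysis.InnerProduct.HilbertComplexEigenspaceSupersymmetry
import HarnessLib

/-!
# Cores of the operators of a Hilbert complex from a core of the Laplacian (Brüning–Lesch 1992, Lemma 2.11):
# if `𝒟̃_i ⊆ 𝒟_i ∩ 𝒟*_{i−1}` is invariant (`D_i 𝒟̃_i ⊆ 𝒟̃_{i+1}`, `D*_{i−1} 𝒟̃_i ⊆ 𝒟̃_{i−1}`) and a core for `Δ`,
# then `𝒟̃_i` is a core for `D_i` (and for `D*_{i−1}`); with the orthogonality criterion for cores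

Layer `Literature/Analysis/InnerProduct`, namespace `Literature.Analysis.InnerProduct`; sequel BY NAME of
`AdjointCompSelfAdjoint.lean` (Kato V Thm 3.24, whose orthogonality argument `graph_le_closure_graph_domRestrict` /
`hasCore_adjointCompSelf` — "`D(T*T)` is a core of `T`" — is generalised in §1 to an arbitrary subspace),
`HilbertComplexLaplacian.lean` (`exists_add_laplacian_eq`, `isClosed_laplacian`), `ClosedHilbertComplexHodgeTheory.lean`
(`laplacian_dual`), `HilbertComplexEigenspaceSupersymmetry.lean` (row g33-#1: the bridges
`laplacian_domain_iff_of_adjointCompSelf` / `…_of_selfCompAdjoint` presenting `T*T`, `SS*` as Laplacians of the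
windows `E →0 E →T F`, `F →S G →0 G`) and `ClosedDenselyDefinedHilbertComplex.lean` (`isClosed_graph_toLp`,
`mem_graph_toLp_iff`, `mem_pmapKer_iff`, `adjoint_adjoint_of_isClosed`, `dense_adjoint_domain_of_isClosed`,
`range_adjoint_le_pmapKer_adjoint`). Lane `lit-hodgefound` (Track 2 foundations library), prover seat
`lit-hodgefound-p06` (generation 34), self-proposed row g34-#4. THEOREMS ONLY (no definition, no instance, no named
fact). Unbounded operators are Mathlib's `LinearPMap` (`T : E →ₗ.[𝕜] F`, adjoint `T†`, `T.IsClosed`,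
`T.HasCore V` = "`V ⊆ D(T)` and the closure of `T|V` is `T`", `T.domRestrict V`); the Laplacians are the
hypothesis-parametrised `A = T*T` (`hdomA`/`hvalA`), `□ = L = TT* + S*S` (`hdom`/`hval`), `C = SS*` (`hdomC`/`hvalC`)
of the previous rows. "The range of `(1 + Δ)|V` is dense" is written in the orthogonality form
`∀ z, (∀ y ∈ V, ⟪y + Δy, z⟫ = 0) → z = 0`, which §2 derives from `Δ.HasCore V`.

## Source, verbatim

J. Brüning, M. Lesch, *Hilbert complexes*, J. Funct. Anal. 108 (1992), §2 pp. 92–93, 97–98 (held text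
`paper:doi-10-1016-0022-1236-92-90147-b`, p0005–p0006, p0010–p0011):

"(Recall that a linear subspace `𝒟̃ ⊂ 𝒟(D)` is called a core for the closed operator `D ∈ 𝒞(H, H′)` if `𝒟̃` is
dense in `𝒟(D)` with respect to the graph norm.) LEMMA 2.11. Let `(𝒟, D)` be a Hilbert complex with Laplacian `Δ`.
If `𝒟̃_i ⊂ 𝒟_i ∩ 𝒟*_{i−1}`, `D_i 𝒟̃_i ⊂ 𝒟̃_{i+1}`, `D*_{i−1} 𝒟̃_i ⊂ 𝒟̃_{i−1}`, and `𝒟̃ := ⊕_{i≥0} 𝒟̃_i` is a core for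
`Δ` then `𝒟̃_i` (2.30) is a core for `D_i`, for all `i ≥ 0`. Proof. By construction, `𝒟̃_i ⊂ 𝒟_i ∩ 𝒟*_{i−1}`. Let
`x ∈ 𝒟_i` be orthogonal to `𝒟̃_i` with respect to the graph scalar product. Then we find for `y ∈ 𝒟̃_{i+1}`
`0 = (x, D_i* y) + (D_i x, D_i D_i* y) = (D_i x, (Δ_{i+1} + id_{H_{i+1}}) y)`, hence `D_i x = 0` since `𝒟̃_{i+1}` is
a core for `Δ_{i+1}`. Similarly, we find for `y ∈ 𝒟̃_{i−1}` `0 = (x, D_{i−1} y) = (D*_{i−1} x, y)`, hence also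
`D*_{i−1} x = 0`, i.e., `x ∈ 𝓗̂_i`. Thus `x = 0`. ∎ A convenient choice for `𝒟̃` is `𝒟̃ = ∩_{k≥1} 𝒟(Δ^k) =: 𝒟^∞`
(2.31). … This can be shown directly but a very easy proof will follow from the discussion after Lemma 2.11 below:
`𝒟̃_i` in (2.31) is a core for `D_i` and `D*_{i−1}`" (the last sentence from the proof of Lemma 2.3, p. 93).

Here one degree is the short complex `0 → E →T F →S G → 0` (`T`, `S` closed densely defined, `Im T ⊆ Ker S`),
`D_i = T` with `Δ_{i+1} = □ = TT* + S*S` (§3), `D_i = S` with `Δ_{i+1} = SS*` (§4), and for the adjoints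
`D*_{i−1} = T*` with `Δ_{i−1} = T*T`, `D*_i = S*` with `Δ_i = □` (§5, the dual complex). In the step
"`(D_i x, D_i D_i* y) = (D_i x, Δ_{i+1} y)`" the extra term `(D_i x, D*_{i+1}D_{i+1} y) = (D_{i+1}D_i x, D_{i+1} y)`
vanishes because `D_i x ∈ ℛ_i ⊆ ker D_{i+1}`; once `D_i x = 0`, graph-orthogonality says `x ⊥ 𝒟̃_i`, and `𝒟̃_i`
is dense in `H_i` (it is a core for the densely defined `Δ_i`), so `x = 0` — the hypothesis actually used below is
this density of `𝒟̃_i`, which §2 (`dense_of_hasCore`) provides from the printed one.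

## What is proved (all over `𝕜 = ℝ` or `ℂ`)

* §1 the orthogonality criterion for cores (the printed first sentence of the proof): **`hasCore_of_forall_graph_inner_eq_zero`**
  — for a closed `T` and `V ⊆ D(T)`: if every `u ∈ D(T)` with `⟪v, u⟫ + ⟪Tv, Tu⟫ = 0` for all `v ∈ V` vanishes, then
  `V` is a core for `T` (`T.HasCore V`); and conversely `eq_zero_of_hasCore_of_forall_graph_inner_eq_zero`.
* §2 cores of `Δ`: `dense_of_hasCore` (a core of a densely defined closed operator is dense),
  **`eq_zero_of_hasCore_of_forall_inner_add_eq_zero`** (if `V` is a core for a closed `Δ` with `1 + Δ` onto, then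
  `(1 + Δ)V` is dense: `z ⊥ (1 + Δ)V ⇒ z = 0`), specialised as `laplacian_core_dense` (`□`),
  `adjointCompSelf_core_dense` (`T*T`), `selfCompAdjoint_core_dense` (`SS*`).
* §3 **Lemma 2.11 for `D_i = T`**: **`hasCore_of_laplacian_core`** — `V_E ⊆ D(T)` dense, `V_F ⊆ D(□)` with
  `T*(V_F) ⊆ V_E` and `(1 + □)V_F` dense ⇒ `V_E` is a core for `T`.
* §4 **Lemma 2.11 for `D_i = S`** (last degree, `Δ_{i+1} = SS*`): **`hasCore_of_selfCompAdjoint_core`**.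
* §5 the dual statements "`𝒟̃_i` is a core for `D*_{i−1}`": **`hasCore_adjoint_of_laplacian_core`** (`V_G` is a core
  for `S*` from a core `V_F` of `□` with `S(V_F) ⊆ V_G`), **`hasCore_adjoint_of_adjointCompSelf_core`** (`V_F` is a core
  for `T*` from a core `V_E` of `T*T` with `T(V_E) ⊆ V_F`).
* §6 **`cores_of_laplacian_cores`** — Lemma 2.11 as printed, for the short complex: `V_E, V_F, V_G` cores for
  `T*T, TT* + S*S, SS*` with `T V_E ⊆ V_F`, `S V_F ⊆ V_G`, `T* V_F ⊆ V_E`, `S* V_G ⊆ V_F` ⇒ `V_E` is a core for `T`,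
  `V_F` is a core for `S` and for `T*`, `V_G` is a core for `S*`.

## References

* [BruningLesch1992] J. Brüning, M. Lesch, *Hilbert complexes*, J. Funct. Anal. 108 (1992) 88–132, §2 Lemma 2.11 with
  (2.30)–(2.31), and the proof of Lemma 2.3 (p. 93).
* [Kato1966] T. Kato, *Perturbation Theory for Linear Operators* (1966), III §5.3 (cores), V §3.7 Thm 3.24 ("`D(T*T)` is
  a core of `T`"; the orthogonality argument, through `AdjointCompSelfAdjoint.lean`).
* [DemaillyAGBook] J.-P. Demailly, *Complex Analytic and Differential Geometry*, Ch. VIII §1 Thm 1.1 (`T** = T`, the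
  graph in `H₁ × H₂`, through `ClosedDenselyDefinedHilbertComplex.lean`).
-/

noncomputable section

open scoped InnerProductSpace LinearPMap

namespace Literature.Analysis.InnerProduct

variable {𝕜 E F G : Type*} [RCLike 𝕜]
variable [NormedAddCommGroup E] [InnerProductSpace 𝕜 E] [CompleteSpace E]
variable [NormedAddCommGroup F] [InnerProductSpace 𝕜 F] [CompleteSpace F]
variable [NormedAddCommGroup G] [InnerProductSpace 𝕜 G] [CompleteSpace G]

/-! ### §0 The zero operator (plumbing for the last degree) -/

section Zero

variable {D : Type*} [NormedAddCommGroup D] [InnerProductSpace 𝕜 D] [CompleteSpace D]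

omit [CompleteSpace E] [CompleteSpace D] in
/-- The zero operator is densely (indeed everywhere) defined. [folklore] -/
private theorem dense_zero_pmap_domain' : Dense (((0 : D →ₗ.[𝕜] E).domain : Submodule 𝕜 D) : Set D) := by
  rw [LinearPMap.zero_domain, Submodule.top_coe]; exact dense_univ

omit [CompleteSpace E] [CompleteSpace D] in
/-- The zero operator (domain everything) is closed: its graph is `D × {0}`. [folklore] -/
private theorem zero_pmap_isClosed' : (0 : D →ₗ.[𝕜] E).IsClosed := by
  have hset : ((0 : D →ₗ.[𝕜] E).graph : Set (D × E)) = Set.univ ×ˢ {0} := by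
    ext p
    rw [SetLike.mem_coe, LinearPMap.mem_graph_iff, Set.mem_prod]
    constructor
    · rintro ⟨y, -, hy⟩
      rw [LinearPMap.zero_apply] at hy
      exact ⟨Set.mem_univ _, Set.mem_singleton_iff.2 hy.symm⟩
    · rintro ⟨-, hp⟩
      exact ⟨⟨p.1, Submodule.mem_top⟩, rfl, by rw [LinearPMap.zero_apply]; exact (Set.mem_singleton_iff.1 hp).symm⟩
  unfold LinearPMap.IsClosed
  rw [hset]
  exact isClosed_univ.prod isClosed_singleton

omit [CompleteSpace E] [CompleteSpace D] in
/-- `Im 0 ⊆ X`. [folklore] -/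
private theorem range_zero_pmap_le' (X : Submodule 𝕜 E) : LinearMap.range (0 : D →ₗ.[𝕜] E).toFun ≤ X := by
  rintro _ ⟨x, rfl⟩
  have h : (0 : D →ₗ.[𝕜] E).toFun x = 0 := LinearPMap.zero_apply x
  rw [h]; exact X.zero_mem

omit [CompleteSpace E] [CompleteSpace D] in
/-- `X ⊆ Ker 0` (everything). [folklore] -/
private theorem le_pmapKer_zero' (X : Submodule 𝕜 D) :
    X ≤ (LinearMap.ker (0 : D →ₗ.[𝕜] E).toFun).map (0 : D →ₗ.[𝕜] E).domain.subtype := fun x _ ↦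
  mem_pmapKer_iff.2 ⟨(Submodule.mem_top : x ∈ (⊤ : Submodule 𝕜 D)), LinearPMap.zero_apply _⟩

end Zero

/-! ### §1 The orthogonality criterion for cores: `V` is a core for a closed `T` iff every vector of the graph of `T`
orthogonal to the graph of `T|V` vanishes -/

section Criterion

variable {T : E →ₗ.[𝕜] F} {V : Submodule 𝕜 E}

/-- **Orthogonality criterion for a core** ("Let `x ∈ 𝒟_i` be orthogonal to `𝒟̃_i` with respect to the graph scalar
product. … Thus `x = 0`" proves that `𝒟̃_i` is a core): if `T` is closed, `V ⊆ D(T)`, and every `u ∈ D(T)` with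
`⟪v, u⟫ + ⟪Tv, Tu⟫ = 0` for all `v ∈ V` is zero, then `V` is a core for `T` — the closure of `T|V` is `T`. (The graph
of `T`, closed in `H × H′`, splits as the closure of the graph of `T|V` plus its orthogonal complement inside the graph;
the hypothesis kills the complement.) [cite: BruningLesch1992, §2 Lemma 2.11 (proof, first and last sentence);
Kato1966, V §3.7 Thm 3.24 (the same argument for `V = D(T*T)`)] -/
theorem hasCore_of_forall_graph_inner_eq_zero (hc : T.IsClosed) (hV : V ≤ T.domain)
    (h : ∀ u : T.domain, (∀ (v : E) (hv : v ∈ T.domain), v ∈ V →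
      ⟪v, (u : E)⟫_𝕜 + ⟪(T ⟨v, hv⟩ : F), (T u : F)⟫_𝕜 = 0) → (u : E) = 0) :
    T.HasCore V := by
  have hRle : T.domRestrict V ≤ T := LinearPMap.domRestrict_le
  have hRcl : (T.domRestrict V).IsClosable := hc.isClosable.leIsClosable hRle
  -- move to the Hilbert space `WithLp 2 (E × F)`
  set e : (E × F) →ₗ[𝕜] WithLp 2 (E × F) := (WithLp.linearEquiv 2 𝕜 (E × F)).symm.toLinearMap with he
  set Gr : Submodule 𝕜 (WithLp 2 (E × F)) := T.graph.map e with hGr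
  set K : Submodule 𝕜 (WithLp 2 (E × F)) := (T.domRestrict V).graph.map e with hK
  have hKG : K ≤ Gr := Submodule.map_mono (LinearPMap.le_graph_of_le hRle)
  have hGc : IsClosed (Gr : Set (WithLp 2 (E × F))) := isClosed_graph_toLp hc
  -- the key orthogonality: `q ∈ Gr`, `q ⊥ K` `⇒ q = 0`
  have key : ∀ q ∈ Gr, q ∈ Kᗮ → q = 0 := by
    intro q hqG hqK
    obtain ⟨u, rfl⟩ := mem_graph_toLp_iff.1 hqG
    have horth : ∀ (v : E) (hv : v ∈ T.domain), v ∈ V →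
        ⟪v, (u : E)⟫_𝕜 + ⟪(T ⟨v, hv⟩ : F), (T u : F)⟫_𝕜 = 0 := by
      intro v hv hvV
      have hvR : v ∈ (T.domRestrict V).domain := by
        rw [LinearPMap.domRestrict_domain]
        exact ⟨hvV, hv⟩
      have hRv : (T.domRestrict V) ⟨v, hvR⟩ = T ⟨v, hv⟩ := LinearPMap.domRestrict_apply rfl
      have hmemK : WithLp.toLp 2 (v, T ⟨v, hv⟩) ∈ K := by
        refine ⟨(v, T ⟨v, hv⟩), ?_, rfl⟩
        have h' := (T.domRestrict V).mem_graph ⟨v, hvR⟩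
        rwa [hRv] at h'
      have h0 := (Submodule.mem_orthogonal _ _).1 hqK _ hmemK
      rwa [WithLp.prod_inner_apply] at h0
    have hu : (u : E) = 0 := h u horth
    have hu' : u = 0 := Subtype.ext hu
    rw [hu', LinearPMap.map_zero, Submodule.coe_zero]
    rfl
  -- hence `Gr ≤ closure K` in `WithLp 2 (E × F)`
  have hGK : (Gr : Set (WithLp 2 (E × F))) ⊆ closure (K : Set (WithLp 2 (E × F))) := by
    intro g hg
    set Kc := K.topologicalClosure with hKc
    haveI : CompleteSpace Kc := (Submodule.isClosed_topologicalClosure K).completeSpace_coe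
    have hKcG : Kc ≤ Gr := K.topologicalClosure_minimal hKG hGc
    have hmem : g ∈ Kc ⊔ Kcᗮ := by
      rw [Submodule.sup_orthogonal_of_hasOrthogonalProjection]
      exact Submodule.mem_top
    obtain ⟨p, hp, q, hq, hpq⟩ := Submodule.mem_sup.1 hmem
    have hqG : q ∈ Gr := by
      have : q = g - p := eq_sub_of_add_eq' hpq
      rw [this]
      exact Gr.sub_mem hg (hKcG hp)
    have hqK : q ∈ Kᗮ := Submodule.orthogonal_le (Submodule.le_topologicalClosure K) hq
    have hq0 := key q hqG hqK
    rw [hq0, add_zero] at hpq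
    rw [← hpq, ← Submodule.topologicalClosure_coe]
    exact hp
  -- back to `E × F`: `graph T ⊆ closure (graph T|V)`
  have hsub : (T.graph : Set (E × F)) ⊆ closure ((T.domRestrict V).graph : Set (E × F)) := by
    intro z hz
    have hz' : WithLp.toLp 2 z ∈ (Gr : Set (WithLp 2 (E × F))) := ⟨z, hz, rfl⟩
    have h1 : WithLp.ofLp (WithLp.toLp 2 z) ∈ WithLp.ofLp '' closure (K : Set (WithLp 2 (E × F))) :=
      ⟨_, hGK hz', rfl⟩
    have h2 := image_closure_subset_closure_image (WithLp.prod_continuous_ofLp 2 E F) h1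
    have hKset : WithLp.ofLp '' (K : Set (WithLp 2 (E × F))) = ((T.domRestrict V).graph : Set (E × F)) := by
      rw [hK, Submodule.map_coe, he, LinearEquiv.coe_coe, WithLp.coe_symm_linearEquiv, Set.image_image]
      simp only [Set.image_id']
    rwa [WithLp.ofLp_toLp, hKset] at h2
  -- conclusion
  refine ⟨hV, LinearPMap.eq_of_eq_graph ?_⟩
  rw [← hRcl.graph_closure_eq_closure_graph]
  refine le_antisymm ((T.domRestrict V).graph.topologicalClosure_minimal (LinearPMap.le_graph_of_le hRle) hc) ?_
  intro z hz
  rw [← SetLike.mem_coe, Submodule.topologicalClosure_coe]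
  exact hsub hz

omit [CompleteSpace E] [CompleteSpace F] in
/-- With a core, the graph of `T` is the closure of the graph of `T|V` ("dense in `𝒟(D)` with respect to the graph
norm"). [cite: BruningLesch1992, §2 before Lemma 2.11 (definition of a core); Kato1966, III §5.3] -/
theorem graph_eq_topologicalClosure_graph_domRestrict_of_hasCore (hc : T.IsClosed) (hcore : T.HasCore V) :
    T.graph = ((T.domRestrict V).graph).topologicalClosure := by
  have hRcl : (T.domRestrict V).IsClosable := hc.isClosable.leIsClosable LinearPMap.domRestrict_le
  rw [hRcl.graph_closure_eq_closure_graph, hcore.closure_eq]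

omit [CompleteSpace E] [CompleteSpace F] in
/-- **Converse of the criterion**: if `V` is a core for the closed `T`, a vector `u ∈ D(T)` with
`⟪v, u⟫ + ⟪Tv, Tu⟫ = 0` for all `v ∈ V` vanishes (the linear functional `(a, b) ↦ ⟪a, u⟫ + ⟪b, Tu⟫` vanishes on the
graph of `T|V`, hence on its closure, which contains `(u, Tu)`). [cite: BruningLesch1992, §2 Lemma 2.11 (proof);
Kato1966, III §5.3] -/
theorem eq_zero_of_hasCore_of_forall_graph_inner_eq_zero (hc : T.IsClosed) (hcore : T.HasCore V) (u : T.domain)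
    (hu : ∀ (v : E) (hv : v ∈ T.domain), v ∈ V → ⟪v, (u : E)⟫_𝕜 + ⟪(T ⟨v, hv⟩ : F), (T u : F)⟫_𝕜 = 0) :
    (u : E) = 0 := by
  have hgr := graph_eq_topologicalClosure_graph_domRestrict_of_hasCore hc hcore
  have hmem : ((u : E), T u) ∈ ((((T.domRestrict V).graph).topologicalClosure : Submodule 𝕜 (E × F)) : Set (E × F)) := by
    rw [← hgr]; exact T.mem_graph u
  rw [Submodule.topologicalClosure_coe] at hmem
  have hclosed : IsClosed {p : E × F | ⟪p.1, (u : E)⟫_𝕜 + ⟪p.2, (T u : F)⟫_𝕜 = 0} :=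
    isClosed_eq ((continuous_fst.inner continuous_const).add (continuous_snd.inner continuous_const))
      continuous_const
  have hsub : ((T.domRestrict V).graph : Set (E × F)) ⊆ {p : E × F | ⟪p.1, (u : E)⟫_𝕜 + ⟪p.2, (T u : F)⟫_𝕜 = 0} := by
    intro p hp
    obtain ⟨y, hy1, hy2⟩ := (LinearPMap.mem_graph_iff _).1 hp
    have hy : (y : E) ∈ V ⊓ T.domain := y.2
    obtain ⟨hyV, hyT⟩ := Submodule.mem_inf.1 hy
    have happ : (T.domRestrict V) y = T ⟨y, hyT⟩ := LinearPMap.domRestrict_apply rfl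
    change ⟪p.1, (u : E)⟫_𝕜 + ⟪p.2, (T u : F)⟫_𝕜 = 0
    rw [← hy1, ← hy2, happ]
    exact hu y hyT hyV
  have h0 : ⟪(u : E), (u : E)⟫_𝕜 + ⟪(T u : F), (T u : F)⟫_𝕜 = 0 := hclosed.closure_subset_iff.2 hsub hmem
  have hre : RCLike.re ⟪(u : E), (u : E)⟫_𝕜 + RCLike.re ⟪(T u : F), (T u : F)⟫_𝕜 = 0 := by
    rw [← map_add, h0, map_zero]
  have h1 : RCLike.re ⟪(u : E), (u : E)⟫_𝕜 = 0 := by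
    have := inner_self_nonneg (𝕜 := 𝕜) (x := (u : E))
    have := inner_self_nonneg (𝕜 := 𝕜) (x := (T u : F))
    linarith
  have h2 : ‖(u : E)‖ ^ 2 = 0 := by rw [@norm_sq_eq_re_inner 𝕜, h1]
  exact norm_eq_zero.1 ((pow_eq_zero_iff two_ne_zero).1 h2)

end Criterion

/-! ### §2 A core of `Δ` is dense, and `(1 + Δ)(core)` is dense -/

section CoreOfLaplacian

variable {L : F →ₗ.[𝕜] F} {V : Submodule 𝕜 F}

omit [CompleteSpace E] [CompleteSpace F] [CompleteSpace G] in
/-- **A core of a densely defined closed operator is dense** (`D(L)` lies in the closure of `V`, since every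
`(y, Ly)` is a limit of points of the graph of `L|V`). [cite: BruningLesch1992, §2 Lemma 2.11 (proof: "`𝒟̃_{i+1}` is a
core for `Δ_{i+1}`" is used through this density); Kato1966, III §5.3] -/
theorem dense_of_hasCore (hc : L.IsClosed) (hd : Dense (L.domain : Set F)) (hcore : L.HasCore V) :
    Dense (V : Set F) := by
  have hgr := graph_eq_topologicalClosure_graph_domRestrict_of_hasCore hc hcore
  have hsub : (L.domain : Set F) ⊆ closure (V : Set F) := by
    intro y hy
    have hmem : (y, L ⟨y, hy⟩) ∈ ((((L.domRestrict V).graph).topologicalClosure : Submodule 𝕜 (F × F)) : Set (F × F)) := by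
      rw [← hgr]; exact L.mem_graph ⟨y, hy⟩
    rw [Submodule.topologicalClosure_coe] at hmem
    have h1 : (y, L ⟨y, hy⟩).1 ∈ Prod.fst '' closure (((L.domRestrict V).graph : Submodule 𝕜 (F × F)) : Set (F × F)) :=
      ⟨_, hmem, rfl⟩
    have h2 := image_closure_subset_closure_image continuous_fst h1
    refine closure_mono ?_ h2
    rintro _ ⟨p, hp, rfl⟩
    obtain ⟨x, hx1, -⟩ := (LinearPMap.mem_graph_iff _).1 hp
    rw [← hx1]
    have hx : (x : F) ∈ V ⊓ L.domain := x.2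
    exact (Submodule.mem_inf.1 hx).1
  exact dense_closure.1 (hd.mono hsub)

omit [CompleteSpace E] [CompleteSpace F] [CompleteSpace G] in
/-- **If `V` is a core for the closed `Δ` and `1 + Δ` is onto, then `(1 + Δ)V` is dense**: a vector `z` with
`⟪y + Δy, z⟫ = 0` for all `y ∈ V` vanishes ("hence `D_i x = 0` since `𝒟̃_{i+1}` is a core for `Δ_{i+1}`": the
functional `(a, b) ↦ ⟪a + b, z⟫` vanishes on the graph of `Δ|V`, hence on the graph of `Δ`, and `z = y₀ + Δy₀`).
[cite: BruningLesch1992, §2 Lemma 2.11 (proof); Kato1966, III §5.3, V §3.7 Thm 3.24] -/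
theorem eq_zero_of_hasCore_of_forall_inner_add_eq_zero (hc : L.IsClosed) (hcore : L.HasCore V)
    (hsurj : ∀ f : F, ∃ y : L.domain, (y : F) + L y = f) {z : F}
    (hz : ∀ (y : F) (hy : y ∈ L.domain), y ∈ V → ⟪y + L ⟨y, hy⟩, z⟫_𝕜 = 0) : z = 0 := by
  have hgr := graph_eq_topologicalClosure_graph_domRestrict_of_hasCore hc hcore
  have hall : ∀ y₀ : L.domain, ⟪(y₀ : F) + L y₀, z⟫_𝕜 = 0 := by
    intro y₀
    have hmem : ((y₀ : F), L y₀) ∈ ((((L.domRestrict V).graph).topologicalClosure : Submodule 𝕜 (F × F)) : Set (F × F)) := by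
      rw [← hgr]; exact L.mem_graph y₀
    rw [Submodule.topologicalClosure_coe] at hmem
    have hclosed : IsClosed {p : F × F | ⟪p.1 + p.2, z⟫_𝕜 = 0} :=
      isClosed_eq ((continuous_fst.add continuous_snd).inner continuous_const) continuous_const
    have hsub : ((L.domRestrict V).graph : Set (F × F)) ⊆ {p : F × F | ⟪p.1 + p.2, z⟫_𝕜 = 0} := by
      intro p hp
      obtain ⟨y, hy1, hy2⟩ := (LinearPMap.mem_graph_iff _).1 hp
      have hy : (y : F) ∈ V ⊓ L.domain := y.2
      obtain ⟨hyV, hyL⟩ := Submodule.mem_inf.1 hy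
      have happ : (L.domRestrict V) y = L ⟨y, hyL⟩ := LinearPMap.domRestrict_apply rfl
      change ⟪p.1 + p.2, z⟫_𝕜 = 0
      rw [← hy1, ← hy2, happ]
      exact hz y hyL hyV
    exact hclosed.closure_subset_iff.2 hsub hmem
  obtain ⟨y₀, hy₀⟩ := hsurj z
  have h := hall y₀
  rw [hy₀] at h
  exact inner_self_eq_zero.1 h

end CoreOfLaplacian

variable {T : E →ₗ.[𝕜] F} {S : F →ₗ.[𝕜] G} {A : E →ₗ.[𝕜] E} {L : F →ₗ.[𝕜] F} {C : G →ₗ.[𝕜] G}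

/-- **A core `V` of `□ = TT* + S*S` has `(1 + □)V` dense** (`1 + □` is onto, `exists_add_laplacian_eq`).
[cite: BruningLesch1992, §2 Lemma 2.11 (proof); Kato1966, V §3.7 Thm 3.24] -/
theorem laplacian_core_dense (hdT : Dense (T.domain : Set E)) (hcT : T.IsClosed)
    (hdS : Dense (S.domain : Set F)) (hcS : S.IsClosed)
    (hST : LinearMap.range T.toFun ≤ (LinearMap.ker S.toFun).map S.domain.subtype)
    (hdom : ∀ x : F, x ∈ L.domain ↔ (∃ hxT : x ∈ T†.domain, T† ⟨x, hxT⟩ ∈ T.domain) ∧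
      (∃ hxS : x ∈ S.domain, S ⟨x, hxS⟩ ∈ S†.domain))
    (hval : ∀ (x : L.domain) (hxT : (x : F) ∈ T†.domain) (hTx : T† ⟨x, hxT⟩ ∈ T.domain)
      (hxS : (x : F) ∈ S.domain) (hSx : S ⟨x, hxS⟩ ∈ S†.domain),
      L x = T ⟨T† ⟨x, hxT⟩, hTx⟩ + S† ⟨S ⟨x, hxS⟩, hSx⟩)
    {V : Submodule 𝕜 F} (hcore : L.HasCore V) (z : F)
    (hz : ∀ (y : F) (hy : y ∈ L.domain), y ∈ V → ⟪y + L ⟨y, hy⟩, z⟫_𝕜 = 0) : z = 0 :=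
  eq_zero_of_hasCore_of_forall_inner_add_eq_zero (isClosed_laplacian hdT hcT hdS hcS hST hdom hval) hcore
    (exists_add_laplacian_eq hdT hcT hdS hcS hST hdom hval) hz

omit [CompleteSpace G] in
/-- **A core `V` of `T*T` has `(1 + T*T)V` dense.** [cite: BruningLesch1992, §2 Lemma 2.11 (proof); Kato1966, V §3.7
Thm 3.24 ("`1 + T*T` has range `H`")] -/
theorem adjointCompSelf_core_dense (hdT : Dense (T.domain : Set E)) (hcT : T.IsClosed)
    (hdomA : ∀ x : E, x ∈ A.domain ↔ ∃ hx : x ∈ T.domain, T ⟨x, hx⟩ ∈ T†.domain)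
    (hvalA : ∀ (x : A.domain) (hx : (x : E) ∈ T.domain) (hTx : T ⟨x, hx⟩ ∈ T†.domain),
      A x = T† ⟨T ⟨x, hx⟩, hTx⟩)
    {V : Submodule 𝕜 E} (hcore : A.HasCore V) (z : E)
    (hz : ∀ (w : E) (hw : w ∈ A.domain), w ∈ V → ⟪w + A ⟨w, hw⟩, z⟫_𝕜 = 0) : z = 0 :=
  eq_zero_of_hasCore_of_forall_inner_add_eq_zero
    (isClosed_laplacian (T := (0 : E →ₗ.[𝕜] E)) (S := T) dense_zero_pmap_domain' zero_pmap_isClosed' hdT hcT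
      (range_zero_pmap_le' _) (laplacian_domain_iff_of_adjointCompSelf hdomA)
      (laplacian_apply_of_adjointCompSelf hvalA)) hcore (exists_add_adjointCompSelf_eq hdT hcT hdomA hvalA) hz

omit [CompleteSpace E] in
/-- **A core `V` of `SS*` has `(1 + SS*)V` dense.** [cite: BruningLesch1992, §2 Lemma 2.11 (proof); Kato1966, V §3.7
Thm 3.24] -/
theorem selfCompAdjoint_core_dense (hdS : Dense (S.domain : Set F)) (hcS : S.IsClosed)
    (hdomC : ∀ y : G, y ∈ C.domain ↔ ∃ hy : y ∈ S†.domain, S† ⟨y, hy⟩ ∈ S.domain)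
    (hvalC : ∀ (y : C.domain) (hy : (y : G) ∈ S†.domain) (hSy : S† ⟨y, hy⟩ ∈ S.domain),
      C y = S ⟨S† ⟨y, hy⟩, hSy⟩)
    {V : Submodule 𝕜 G} (hcore : C.HasCore V) (z : G)
    (hz : ∀ (w : G) (hw : w ∈ C.domain), w ∈ V → ⟪w + C ⟨w, hw⟩, z⟫_𝕜 = 0) : z = 0 :=
  eq_zero_of_hasCore_of_forall_inner_add_eq_zero
    (isClosed_laplacian (T := S) (S := (0 : G →ₗ.[𝕜] G)) hdS hcS dense_zero_pmap_domain' zero_pmap_isClosed'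
      (le_pmapKer_zero' _) (laplacian_domain_iff_of_selfCompAdjoint hdomC) (laplacian_apply_of_selfCompAdjoint hvalC))
    hcore (exists_add_laplacian_eq (T := S) (S := (0 : G →ₗ.[𝕜] G)) hdS hcS dense_zero_pmap_domain'
      zero_pmap_isClosed' (le_pmapKer_zero' _) (laplacian_domain_iff_of_selfCompAdjoint hdomC)
      (laplacian_apply_of_selfCompAdjoint hvalC)) hz

/-! ### §3 Lemma 2.11 for `D_i = T`: a core of `□ = TT* + S*S` mapped by `T*` into a dense `V_E ⊆ D(T)` makes
`V_E` a core for `T` -/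

omit [CompleteSpace G] in
/-- **Brüning–Lesch, Lemma 2.11 (degree of `T`)**: let `V_E ⊆ D(T)` be dense in `E` and `V_F ⊆ D(□)` with
`T*(V_F) ⊆ V_E` and `(1 + □)V_F` dense (e.g. `V_F` a core for `□`, `laplacian_core_dense`). Then `V_E` is a core for
`T`. Proof as printed: if `u ∈ D(T)` is graph-orthogonal to `V_E`, then for `y ∈ V_F`
`⟪y + □y, Tu⟫ = ⟪T*y, u⟫ + ⟪TT*y, Tu⟫ + ⟪S*Sy, Tu⟫ = 0 + ⟪Sy, STu⟫ = 0` (`T*y ∈ V_E`; `Tu ∈ Ker S`), so `Tu = 0`; then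
`u ⊥ V_E`, which is dense, so `u = 0`. [cite: BruningLesch1992, §2 Lemma 2.11 ("`0 = (x, D_i* y) + (D_i x, D_i D_i* y) =
(D_i x, (Δ_{i+1} + id) y)`, hence `D_i x = 0` … Thus `x = 0`")] -/
theorem hasCore_of_laplacian_core (hdT : Dense (T.domain : Set E)) (hcT : T.IsClosed)
    (hdS : Dense (S.domain : Set F))
    (hST : LinearMap.range T.toFun ≤ (LinearMap.ker S.toFun).map S.domain.subtype)
    (hdom : ∀ x : F, x ∈ L.domain ↔ (∃ hxT : x ∈ T†.domain, T† ⟨x, hxT⟩ ∈ T.domain) ∧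
      (∃ hxS : x ∈ S.domain, S ⟨x, hxS⟩ ∈ S†.domain))
    (hval : ∀ (x : L.domain) (hxT : (x : F) ∈ T†.domain) (hTx : T† ⟨x, hxT⟩ ∈ T.domain)
      (hxS : (x : F) ∈ S.domain) (hSx : S ⟨x, hxS⟩ ∈ S†.domain),
      L x = T ⟨T† ⟨x, hxT⟩, hTx⟩ + S† ⟨S ⟨x, hxS⟩, hSx⟩)
    {V_E : Submodule 𝕜 E} {V_F : Submodule 𝕜 F}
    (hVE : V_E ≤ T.domain) (hVEd : Dense (V_E : Set E))
    (hinv : ∀ (y : F) (hy : y ∈ T†.domain), y ∈ V_F → (T† ⟨y, hy⟩ : E) ∈ V_E)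
    (hcore : ∀ z : F, (∀ (y : F) (hy : y ∈ L.domain), y ∈ V_F → ⟪y + L ⟨y, hy⟩, z⟫_𝕜 = 0) → z = 0) :
    T.HasCore V_E := by
  refine hasCore_of_forall_graph_inner_eq_zero hcT hVE fun u hu ↦ ?_
  -- Step 1: `Tu = 0`, testing against `(1 + □)V_F`
  have hTu : T u = 0 := by
    refine hcore (T u) fun y hyL hyV ↦ ?_
    obtain ⟨⟨hyT, hTy⟩, ⟨hyS, hSy⟩⟩ := (hdom y).1 hyL
    rw [hval ⟨y, hyL⟩ hyT hTy hyS hSy, inner_add_left, inner_add_left]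
    -- `⟪y, Tu⟫ = ⟪T*y, u⟫`
    have h1 : ⟪y, (T u : F)⟫_𝕜 = ⟪(T† ⟨y, hyT⟩ : E), (u : E)⟫_𝕜 :=
      (LinearPMap.adjoint_isFormalAdjoint hdT ⟨y, hyT⟩ u).symm
    -- `⟪T*y, u⟫ + ⟪TT*y, Tu⟫ = 0` since `T*y ∈ V_E`
    have h2 := hu (T† ⟨y, hyT⟩) hTy (hinv y hyT hyV)
    -- `⟪S*Sy, Tu⟫ = ⟪Sy, S(Tu)⟫ = 0` since `Tu ∈ Im T ⊆ Ker S`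
    have hTuK : (T u : F) ∈ (LinearMap.ker S.toFun).map S.domain.subtype := hST (LinearMap.mem_range_self _ u)
    obtain ⟨hTuS, hSTu⟩ := mem_pmapKer_iff.1 hTuK
    have h3 : ⟪(S† ⟨S ⟨y, hyS⟩, hSy⟩ : F), (T u : F)⟫_𝕜 = 0 := by
      have h := LinearPMap.adjoint_isFormalAdjoint hdS ⟨S ⟨y, hyS⟩, hSy⟩ ⟨T u, hTuS⟩
      have h' : ⟪(S† ⟨S ⟨y, hyS⟩, hSy⟩ : F), (T u : F)⟫_𝕜 = ⟪(S ⟨y, hyS⟩ : G), S ⟨T u, hTuS⟩⟫_𝕜 := h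
      rw [h', hSTu, inner_zero_right]
    rw [h1, h3, add_zero]
    exact h2
  -- Step 2: `u ⊥ V_E`, which is dense
  refine hVEd.eq_zero_of_inner_right (𝕜 := 𝕜) fun v hv ↦ ?_
  have h := hu v (hVE hv) hv
  rwa [hTu, inner_zero_right, add_zero] at h

/-! ### §4 Lemma 2.11 for `D_i = S` in the last degree: a core of `SS*` mapped by `S*` into a dense `V_F ⊆ D(S)` -/

omit [CompleteSpace E] in
/-- **Brüning–Lesch, Lemma 2.11 (degree of `S`, last degree)**: let `V_F ⊆ D(S)` be dense in `F` and `V_G ⊆ D(SS*)`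
with `S*(V_G) ⊆ V_F` and `(1 + SS*)V_G` dense (e.g. `V_G` a core for `SS*`, `selfCompAdjoint_core_dense`). Then
`V_F` is a core for `S` (the previous statement for the window `F →S G →0 G`, whose Laplacian on `G` is `SS*`).
[cite: BruningLesch1992, §2 Lemma 2.11] -/
theorem hasCore_of_selfCompAdjoint_core (hdS : Dense (S.domain : Set F)) (hcS : S.IsClosed)
    (hdomC : ∀ y : G, y ∈ C.domain ↔ ∃ hy : y ∈ S†.domain, S† ⟨y, hy⟩ ∈ S.domain)
    (hvalC : ∀ (y : C.domain) (hy : (y : G) ∈ S†.domain) (hSy : S† ⟨y, hy⟩ ∈ S.domain),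
      C y = S ⟨S† ⟨y, hy⟩, hSy⟩)
    {V_F : Submodule 𝕜 F} {V_G : Submodule 𝕜 G}
    (hVF : V_F ≤ S.domain) (hVFd : Dense (V_F : Set F))
    (hinv : ∀ (z : G) (hz : z ∈ S†.domain), z ∈ V_G → (S† ⟨z, hz⟩ : F) ∈ V_F)
    (hcore : ∀ w : G, (∀ (z : G) (hz : z ∈ C.domain), z ∈ V_G → ⟪z + C ⟨z, hz⟩, w⟫_𝕜 = 0) → w = 0) :
    S.HasCore V_F :=
  hasCore_of_laplacian_core (T := S) (S := (0 : G →ₗ.[𝕜] G)) (L := C) hdS hcS dense_zero_pmap_domain'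
    (le_pmapKer_zero' _) (laplacian_domain_iff_of_selfCompAdjoint hdomC) (laplacian_apply_of_selfCompAdjoint hvalC)
    hVF hVFd hinv hcore

/-! ### §5 "`𝒟̃_i` is a core for `D*_{i−1}`": the dual statements for `S*` and `T*` -/

/-- **Lemma 2.11 for `S*` (the dual complex `G →S* F →T* E`, whose Laplacian on `F` is again `□`)**: let
`V_G ⊆ D(S*)` be dense in `G` and `V_F ⊆ D(□)` with `S(V_F) ⊆ V_G` and `(1 + □)V_F` dense. Then `V_G` is a core for
`S*`. [cite: BruningLesch1992, §2 Lemma 2.11 with (2.5)–(2.6), (2.8b), and the proof of Lemma 2.3 ("is a core for `D_i`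
and `D*_{i−1}`")] -/
theorem hasCore_adjoint_of_laplacian_core (hdT : Dense (T.domain : Set E)) (hcT : T.IsClosed)
    (hdS : Dense (S.domain : Set F)) (hcS : S.IsClosed)
    (hST : LinearMap.range T.toFun ≤ (LinearMap.ker S.toFun).map S.domain.subtype)
    (hdom : ∀ x : F, x ∈ L.domain ↔ (∃ hxT : x ∈ T†.domain, T† ⟨x, hxT⟩ ∈ T.domain) ∧
      (∃ hxS : x ∈ S.domain, S ⟨x, hxS⟩ ∈ S†.domain))
    (hval : ∀ (x : L.domain) (hxT : (x : F) ∈ T†.domain) (hTx : T† ⟨x, hxT⟩ ∈ T.domain)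
      (hxS : (x : F) ∈ S.domain) (hSx : S ⟨x, hxS⟩ ∈ S†.domain),
      L x = T ⟨T† ⟨x, hxT⟩, hTx⟩ + S† ⟨S ⟨x, hxS⟩, hSx⟩)
    {V_G : Submodule 𝕜 G} {V_F : Submodule 𝕜 F}
    (hVG : V_G ≤ S†.domain) (hVGd : Dense (V_G : Set G))
    (hinv : ∀ (y : F) (hy : y ∈ S.domain), y ∈ V_F → (S ⟨y, hy⟩ : G) ∈ V_G)
    (hcore : ∀ z : F, (∀ (y : F) (hy : y ∈ L.domain), y ∈ V_F → ⟪y + L ⟨y, hy⟩, z⟫_𝕜 = 0) → z = 0) :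
    S†.HasCore V_G := by
  obtain ⟨hdom', hval'⟩ := laplacian_dual hdT hcT hdS hcS hdom hval
  have hinv' : ∀ (y : F) (hy : y ∈ S††.domain), y ∈ V_F → (S†† ⟨y, hy⟩ : G) ∈ V_G := by
    rw [adjoint_adjoint_of_isClosed hdS hcS]
    exact hinv
  exact hasCore_of_laplacian_core (T := S†) (S := T†) (L := L) (dense_adjoint_domain_of_isClosed hdS hcS)
    (LinearPMap.adjoint_isClosed hdS) (dense_adjoint_domain_of_isClosed hdT hcT)
    (range_adjoint_le_pmapKer_adjoint hdS hST) hdom' hval' hVG hVGd hinv' hcore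

omit [CompleteSpace G] in
/-- **Lemma 2.11 for `T*` (the dual complex, last degree: the Laplacian on `E` is `T*T = T*T**`)**: let
`V_F ⊆ D(T*)` be dense in `F` and `V_E ⊆ D(T*T)` with `T(V_E) ⊆ V_F` and `(1 + T*T)V_E` dense. Then `V_F` is a core
for `T*`. [cite: BruningLesch1992, §2 Lemma 2.11 and the proof of Lemma 2.3 ("`𝒟̃_i` … is a core for `D_i` and
`D*_{i−1}`"); Kato1966, V §3.7 Thm 3.24] -/
theorem hasCore_adjoint_of_adjointCompSelf_core (hdT : Dense (T.domain : Set E)) (hcT : T.IsClosed)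
    (hdomA : ∀ x : E, x ∈ A.domain ↔ ∃ hx : x ∈ T.domain, T ⟨x, hx⟩ ∈ T†.domain)
    (hvalA : ∀ (x : A.domain) (hx : (x : E) ∈ T.domain) (hTx : T ⟨x, hx⟩ ∈ T†.domain),
      A x = T† ⟨T ⟨x, hx⟩, hTx⟩)
    {V_F : Submodule 𝕜 F} {V_E : Submodule 𝕜 E}
    (hVF : V_F ≤ T†.domain) (hVFd : Dense (V_F : Set F))
    (hinv : ∀ (w : E) (hw : w ∈ T.domain), w ∈ V_E → (T ⟨w, hw⟩ : F) ∈ V_F)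
    (hcore : ∀ x : E, (∀ (w : E) (hw : w ∈ A.domain), w ∈ V_E → ⟪w + A ⟨w, hw⟩, x⟫_𝕜 = 0) → x = 0) :
    T†.HasCore V_F := by
  have hdomA' : ∀ x : E, x ∈ A.domain ↔ ∃ hx : x ∈ T††.domain, T†† ⟨x, hx⟩ ∈ T†.domain := by
    rw [adjoint_adjoint_of_isClosed hdT hcT]
    exact hdomA
  have hvalA' : ∀ (x : A.domain) (hx : (x : E) ∈ T††.domain) (hTx : T†† ⟨x, hx⟩ ∈ T†.domain),
      A x = T† ⟨T†† ⟨x, hx⟩, hTx⟩ := by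
    rw [adjoint_adjoint_of_isClosed hdT hcT]
    exact hvalA
  have hinv' : ∀ (w : E) (hw : w ∈ T††.domain), w ∈ V_E → (T†† ⟨w, hw⟩ : F) ∈ V_F := by
    rw [adjoint_adjoint_of_isClosed hdT hcT]
    exact hinv
  exact hasCore_of_selfCompAdjoint_core (S := T†) (C := A) (dense_adjoint_domain_of_isClosed hdT hcT)
    (LinearPMap.adjoint_isClosed hdT) hdomA' hvalA' hVF hVFd hinv' hcore

/-! ### §6 Lemma 2.11 as printed, for the short complex `0 → E →T F →S G → 0` -/

/-- **Brüning–Lesch, Lemma 2.11, for a short Hilbert complex.** Let `V_E ⊆ D(T*T)`, `V_F ⊆ D(□)`, `V_G ⊆ D(SS*)` be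
cores for the three Laplacians `T*T`, `□ = TT* + S*S`, `SS*`, invariant in the sense `T V_E ⊆ V_F`, `S V_F ⊆ V_G`,
`T* V_F ⊆ V_E`, `S* V_G ⊆ V_F` ("`𝒟̃_i ⊂ 𝒟_i ∩ 𝒟*_{i−1}`, `D_i 𝒟̃_i ⊂ 𝒟̃_{i+1}`, `D*_{i−1} 𝒟̃_i ⊂ 𝒟̃_{i−1}`, and
`𝒟̃` is a core for `Δ`"). Then `V_E` is a core for `T`, `V_F` is a core for `S` and for `T*`, and `V_G` is a core
for `S*`. [cite: BruningLesch1992, §2 Lemma 2.11 with (2.30), and the proof of Lemma 2.3 ("a core for `D_i` and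
`D*_{i−1}`")] -/
theorem cores_of_laplacian_cores (hdT : Dense (T.domain : Set E)) (hcT : T.IsClosed)
    (hdS : Dense (S.domain : Set F)) (hcS : S.IsClosed)
    (hST : LinearMap.range T.toFun ≤ (LinearMap.ker S.toFun).map S.domain.subtype)
    (hdomA : ∀ x : E, x ∈ A.domain ↔ ∃ hx : x ∈ T.domain, T ⟨x, hx⟩ ∈ T†.domain)
    (hvalA : ∀ (x : A.domain) (hx : (x : E) ∈ T.domain) (hTx : T ⟨x, hx⟩ ∈ T†.domain),
      A x = T† ⟨T ⟨x, hx⟩, hTx⟩)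
    (hdom : ∀ x : F, x ∈ L.domain ↔ (∃ hxT : x ∈ T†.domain, T† ⟨x, hxT⟩ ∈ T.domain) ∧
      (∃ hxS : x ∈ S.domain, S ⟨x, hxS⟩ ∈ S†.domain))
    (hval : ∀ (x : L.domain) (hxT : (x : F) ∈ T†.domain) (hTx : T† ⟨x, hxT⟩ ∈ T.domain)
      (hxS : (x : F) ∈ S.domain) (hSx : S ⟨x, hxS⟩ ∈ S†.domain),
      L x = T ⟨T† ⟨x, hxT⟩, hTx⟩ + S† ⟨S ⟨x, hxS⟩, hSx⟩)
    (hdomC : ∀ y : G, y ∈ C.domain ↔ ∃ hy : y ∈ S†.domain, S† ⟨y, hy⟩ ∈ S.domain)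
    (hvalC : ∀ (y : C.domain) (hy : (y : G) ∈ S†.domain) (hSy : S† ⟨y, hy⟩ ∈ S.domain),
      C y = S ⟨S† ⟨y, hy⟩, hSy⟩)
    {V_E : Submodule 𝕜 E} {V_F : Submodule 𝕜 F} {V_G : Submodule 𝕜 G}
    (hcoreE : A.HasCore V_E) (hcoreF : L.HasCore V_F) (hcoreG : C.HasCore V_G)
    (hTV : ∀ (w : E) (hw : w ∈ T.domain), w ∈ V_E → (T ⟨w, hw⟩ : F) ∈ V_F)
    (hSV : ∀ (y : F) (hy : y ∈ S.domain), y ∈ V_F → (S ⟨y, hy⟩ : G) ∈ V_G)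
    (hTaV : ∀ (y : F) (hy : y ∈ T†.domain), y ∈ V_F → (T† ⟨y, hy⟩ : E) ∈ V_E)
    (hSaV : ∀ (z : G) (hz : z ∈ S†.domain), z ∈ V_G → (S† ⟨z, hz⟩ : F) ∈ V_F) :
    T.HasCore V_E ∧ S.HasCore V_F ∧ T†.HasCore V_F ∧ S†.HasCore V_G := by
  -- the cores lie in the domains and are dense
  have hVE : V_E ≤ T.domain := fun w hw ↦ ((hdomA w).1 (hcoreE.le_domain hw)).1
  have hVF_S : V_F ≤ S.domain := fun y hy ↦ ((hdom y).1 (hcoreF.le_domain hy)).2.1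
  have hVF_T : V_F ≤ T†.domain := fun y hy ↦ ((hdom y).1 (hcoreF.le_domain hy)).1.1
  have hVG : V_G ≤ S†.domain := fun z hz ↦ ((hdomC z).1 (hcoreG.le_domain hz)).1
  have hcA := isClosed_laplacian (T := (0 : E →ₗ.[𝕜] E)) (S := T) dense_zero_pmap_domain' zero_pmap_isClosed' hdT
    hcT (range_zero_pmap_le' _) (laplacian_domain_iff_of_adjointCompSelf hdomA) (laplacian_apply_of_adjointCompSelf hvalA)
  have hcL := isClosed_laplacian hdT hcT hdS hcS hST hdom hval
  have hcC := isClosed_laplacian (T := S) (S := (0 : G →ₗ.[𝕜] G)) hdS hcS dense_zero_pmap_domain' zero_pmap_isClosed'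
    (le_pmapKer_zero' _) (laplacian_domain_iff_of_selfCompAdjoint hdomC) (laplacian_apply_of_selfCompAdjoint hvalC)
  have hdA := dense_laplacian_domain (T := (0 : E →ₗ.[𝕜] E)) (S := T) dense_zero_pmap_domain' zero_pmap_isClosed'
    hdT hcT (range_zero_pmap_le' _) (laplacian_domain_iff_of_adjointCompSelf hdomA)
    (laplacian_apply_of_adjointCompSelf hvalA)
  have hdL := dense_laplacian_domain hdT hcT hdS hcS hST hdom hval
  have hdC := dense_laplacian_domain (T := S) (S := (0 : G →ₗ.[𝕜] G)) hdS hcS dense_zero_pmap_domain'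
    zero_pmap_isClosed' (le_pmapKer_zero' _) (laplacian_domain_iff_of_selfCompAdjoint hdomC)
    (laplacian_apply_of_selfCompAdjoint hvalC)
  have hVEd : Dense (V_E : Set E) := dense_of_hasCore hcA hdA hcoreE
  have hVFd : Dense (V_F : Set F) := dense_of_hasCore hcL hdL hcoreF
  have hVGd : Dense (V_G : Set G) := dense_of_hasCore hcC hdC hcoreG
  refine ⟨?_, ?_, ?_, ?_⟩
  · exact hasCore_of_laplacian_core hdT hcT hdS hST hdom hval hVE hVEd hTaV
      (laplacian_core_dense hdT hcT hdS hcS hST hdom hval hcoreF)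
  · exact hasCore_of_selfCompAdjoint_core hdS hcS hdomC hvalC hVF_S hVFd hSaV
      (selfCompAdjoint_core_dense hdS hcS hdomC hvalC hcoreG)
  · exact hasCore_adjoint_of_adjointCompSelf_core hdT hcT hdomA hvalA hVF_T hVFd hTV
      (adjointCompSelf_core_dense hdT hcT hdomA hvalA hcoreE)
  · exact hasCore_adjoint_of_laplacian_core hdT hcT hdS hcS hST hdom hval hVG hVGd hSV
      (laplacian_core_dense hdT hcT hdS hcS hST hdom hval hcoreF)

end Literature.Analysis.InnerProduct
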